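import Summits.AnomalousDissipation.AnomalousDissipation.Theorems.MarginalStabilityChainStrainedLayerLawClockStubNegEnstrophyLawB
import Summits.AnomalousDissipation.AnomalousDissipation.Theorems.MarginalStabilityChainStrainedLayerLawClockStubNegEnstrophyLawC
import Summits.AnomalousDissipation.AnomalousDissipation.Theorems.MarginalStabilityChainStrainedLayerLawStubVorticityUniformBoundsG
import Mathlib.MeasureTheory.Integral.IntervalIntegral.FundThmCalculus

/-!
# Stub `stub_negEnstrophyLaw` of line `FirstLemmasR2K4` (log-enstrophy clock; crux `MarginalStabilityChain.StrainedLayerLaw`,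
# stmt-AnomalousDissipation-3007) — tools D: the renormalised balance along a solution, integrated in time at one
# regularisation / cutoff level

Support file (`--supports stmt-AnomalousDissipation-3007`; registered sub-goal `stub_negEnstrophyLaw_level`). For a
classical solution `(u, v, p)` of the stretched two-dimensional Navier–Stokes layer system on `(0, ∞)` (`ν ≥ 0`,
`L > 0`), a function `F ∈ C²(ℝ)` with `|F(s)| ≤ |s|(|s| + ε)`, `|F′(s)| ≤ 2(|s| + ε)` (the regularisation `F_ε` of
`s₋²`, tools A, is the intended instance) and a cutoff `ψ` (`C¹`, `|ψ| ≤ 1`, `ψ = 0` for `|y| ≥ 2R`, `|ψ′| ≤ D`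
supported in `|y| ≤ 2R`):
* `clock_slice_identity`: the renormalised balance of tools B along the solution at time `t > 0`,
  `∫∫ F′(ω)ψ ∂ₜω = A(t) + B(t) − νC(t) − νE(t)` with `A = ∫∫ (ωF′(ω) − F(ω))ψ`, `B = ∫∫ F(ω)(v − y)ψ′`,
  `C = ∫∫ F″(ω)|∇ω|²ψ`, `E = ∫∫ F′(ω)∂_yω ψ′`;
* `clock_rhs_bound`: under shear tails `SliceTails C k`, `|B| + ν|E| ≤ D(C + ε)C(∫∫(C + |y|)e^{−k|y|} + 2ν∫∫e^{−k|y|})`;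
* continuity in time of `A, B, C, E` (tools C);
* `stub_negEnstrophyLaw_level`: for `0 < s ≤ t′` with tails on `[s, t′]`,
  `|N(t′) − N(s) − ∫_s^{t′} (A − νC)| ≤ (t′ − s)·D(C + ε)C(IW + 2νI_k)`, `N(τ) = ∫∫ F(ω(τ))ψ`
  (differentiation under the integral, tools C; the fundamental theorem of calculus on `[s, t′]`).
All `[folklore]`.
-/

-- `Summit.<Summit>.<Problem>` is the tree's mandated summit-side namespace (CONVENTIONS §2); for this
-- single-conjunct summit the two coincide, so the duplicate is deliberate.
set_option linter.dupNamespace false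

noncomputable section

open scoped Topology ENNReal
open Filter Set Function MeasureTheory

namespace Summit.AnomalousDissipation.AnomalousDissipation.Theorems.StrainedLayerLaw.LogEnstrophyClock

open Literature.Analysis.FluidPDE Literature.Analysis.FluidPDE.StretchedLayer
open Summit.AnomalousDissipation.AnomalousDissipation.Theses.MarginalStabilityChain
open Summit.AnomalousDissipation.AnomalousDissipation.Theorems.StrainedLayerLaw.StrainWorkSumRule

/-! ## The renormalised balance along a solution -/

section SliceIdentity

variable {ν L : ℝ} {u v p : ℝ → ℝ → ℝ → ℝ}

/-- **The renormalised vorticity balance along a classical solution** at time `t > 0` (tools B applied to the slices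
at time `t`; the time-derivative slices are `C¹`, `x`-periodic and satisfy the momentum equations):
`∫∫ F′(ω(t))ψ (∂ₓ∂ₜv − ∂_y∂ₜu) = ∫∫ (ωF′(ω) − F(ω))ψ + ∫∫ F(ω)(v − y)ψ′ − ν∫∫ F″(ω)|∇ω|²ψ − ν∫∫ F′(ω)∂_yω ψ′`.
[folklore] -/
theorem clock_slice_identity (hsol : IsStretchedLayerNSSolutionOn (Ioi 0) ν 1 1 L u v p) (hL : 0 < L)
    {t : ℝ} (ht : 0 < t) {F F' F'' : ℝ → ℝ} (hF : ∀ s, HasDerivAt F (F' s) s) (hF' : ∀ s, HasDerivAt F' (F'' s) s)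
    (hF'1 : ContDiff ℝ 1 F') (hF''c : Continuous F'') {ψ : ℝ → ℝ} (hψ : ContDiff ℝ 1 ψ) {R' : ℝ}
    (hψR : ∀ y, R' ≤ |y| → ψ y = 0) :
    ∫ q in Ioc 0 L ×ˢ univ, F' (vorticity (u t) (v t) q.1 q.2) * ψ q.2 *
        (dX (fun x y => deriv (fun s => v s x y) t) q.1 q.2 - dY (fun x y => deriv (fun s => u s x y) t) q.1 q.2) =
      (∫ q in Ioc 0 L ×ˢ univ, (vorticity (u t) (v t) q.1 q.2 * F' (vorticity (u t) (v t) q.1 q.2) -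
          F (vorticity (u t) (v t) q.1 q.2)) * ψ q.2) +
        (∫ q in Ioc 0 L ×ˢ univ, F (vorticity (u t) (v t) q.1 q.2) * (v t q.1 q.2 - q.2) * deriv ψ q.2) -
        ν * (∫ q in Ioc 0 L ×ˢ univ, F'' (vorticity (u t) (v t) q.1 q.2) *
          (dX (vorticity (u t) (v t)) q.1 q.2 ^ 2 + dY (vorticity (u t) (v t)) q.1 q.2 ^ 2) * ψ q.2) -
        ν * ∫ q in Ioc 0 L ×ˢ univ,
          F' (vorticity (u t) (v t) q.1 q.2) * dY (vorticity (u t) (v t)) q.1 q.2 * deriv ψ q.2 := by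
  have ht' : t ∈ Ioi (0:ℝ) := ht
  refine stub_negEnstrophyLaw_static L ν R' (u t) (v t) (p t)
    (fun x y => deriv (fun s => u s x y) t) (fun x y => deriv (fun s => v s x y) t) ψ F F' F'' hL
    (hsol.contDiff_u ht') (hsol.contDiff_v ht') (hsol.contDiff_p ht')
    (kato_contDiff_deriv_time_slice hsol.contDiffOn_u ht) (kato_contDiff_deriv_time_slice hsol.contDiffOn_v ht)
    (fun x y => ?_) (fun x y => ?_) (hsol.divFree t ht') (hsol.periodic_u t ht') (hsol.periodic_v t ht')
    (hsol.periodic_p t ht') (fun x y => ?_) hψ hψR hF hF' hF'1 hF''c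
  · have h := hsol.momentum_x t ht' x y
    rw [dT_of_isOpen isOpen_Ioi u ht', one_mul] at h
    exact h
  · have h := hsol.momentum_y t ht' x y
    rw [dT_of_isOpen isOpen_Ioi v ht', one_mul, one_mul] at h
    exact h
  · exact kato_deriv_time_periodic (fun s hs x y => hsol.periodic_v s hs x y) ht x y

end SliceIdentity

/-! ## The cutoff-transition terms are small in the shear-tails class -/

section RhsBound

/-- **The cutoff-transition terms of the renormalised balance are small.** For a `C²` divergence-free slice with
`SliceTails C k`, `|F(s)| ≤ |s|(|s| + ε)`, `|F′(s)| ≤ 2(|s| + ε)` (`ε ≥ 0`) and a cutoff whose derivative is bounded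
by `D` and supported in `|y| ≤ 2R` (`ν ≥ 0`):
`|∫∫ F(ω)(v − y)ψ′| + ν|∫∫ F′(ω)∂_yω ψ′| ≤ D(C + ε)C(∫∫(C + |y|)e^{−k|y|} + 2ν∫∫e^{−k|y|})`. [folklore] -/
theorem clock_rhs_bound {L C k : ℝ} (hk : 0 < k) {f g : ℝ → ℝ → ℝ} (hT : SliceTails C k f g)
    (hf : ContDiff ℝ 2 (fun q : ℝ × ℝ => f q.1 q.2)) (hg : ContDiff ℝ 2 (fun q : ℝ × ℝ => g q.1 q.2))
    (hdiv : ∀ x y, dX f x y + dY g x y = 0) {F F' : ℝ → ℝ} (cF : Continuous F) (cF' : Continuous F')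
    {ε : ℝ} (hε : 0 ≤ ε) (hFb : ∀ s, |F s| ≤ |s| * (|s| + ε)) (hF'b : ∀ s, |F' s| ≤ 2 * (|s| + ε))
    {ψ : ℝ → ℝ} (hψ : ContDiff ℝ 1 ψ) {R D : ℝ} (hψ'b : ∀ y, |deriv ψ y| ≤ D)
    (hψ'0 : ∀ y, 2 * R < |y| → deriv ψ y = 0) {ν : ℝ} (hν : 0 ≤ ν) :
    |∫ q in Ioc 0 L ×ˢ univ, F (vorticity f g q.1 q.2) * (g q.1 q.2 - q.2) * deriv ψ q.2| +
        ν * |∫ q in Ioc 0 L ×ˢ univ, F' (vorticity f g q.1 q.2) * dY (vorticity f g) q.1 q.2 * deriv ψ q.2| ≤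
      D * (C + ε) * C * ((∫ q in Ioc 0 L ×ˢ univ, (C + |q.2|) * Real.exp (-k * |q.2|)) +
        2 * ν * ∫ q in Ioc 0 L ×ˢ univ, Real.exp (-k * |q.2|)) := by
  have hC : 0 ≤ C := hT.nonneg
  have hω1 : ContDiff ℝ 1 (fun q : ℝ × ℝ => vorticity f g q.1 q.2) := contDiff_one_vorticity hf hg
  have cω : Continuous fun q : ℝ × ℝ => vorticity f g q.1 q.2 := hω1.continuous
  have cωy : Continuous fun q : ℝ × ℝ => dY (vorticity f g) q.1 q.2 := continuous_dY hω1
  have cg : Continuous fun q : ℝ × ℝ => g q.1 q.2 := hg.continuous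
  have cψ' : Continuous (deriv ψ) := hψ.continuous_deriv le_rfl
  have cFω : Continuous fun q : ℝ × ℝ => F (vorticity f g q.1 q.2) := cF.comp cω
  have cF'ω : Continuous fun q : ℝ × ℝ => F' (vorticity f g q.1 q.2) := cF'.comp cω
  have hψ'0' : ∀ y, 2 * R + 1 ≤ |y| → deriv ψ y = 0 := fun y hy => hψ'0 y (by linarith)
  have iW := kato_integrableOn_weight' hk hC L
  have ik := kato_integrableOn_weight hk L
  have hωb : ∀ x y, |vorticity f g x y| ≤ C * Real.exp (-k * |y|) := tails_abs_vorticity_le hT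
  have hωyb : ∀ x y, |dY (vorticity f g) x y| ≤ C * Real.exp (-k * |y|) := kato_abs_dY_vorticity_le hT hf hg hdiv
  have hle1 : ∀ y : ℝ, Real.exp (-k * |y|) ≤ 1 := fun y => Real.exp_le_one_iff.2 (by nlinarith [abs_nonneg y])
  have hωC : ∀ x y, |vorticity f g x y| ≤ C := fun x y => (hωb x y).trans (mul_le_of_le_one_right hC (hle1 y))
  set IW : ℝ := ∫ q in Ioc 0 L ×ˢ univ, (C + |q.2|) * Real.exp (-k * |q.2|) with hIW
  set Ik : ℝ := ∫ q in Ioc 0 L ×ˢ univ, Real.exp (-k * |q.2|) with hIk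
  -- the first term
  have e1 : |∫ q in Ioc 0 L ×ˢ univ, F (vorticity f g q.1 q.2) * (g q.1 q.2 - q.2) * deriv ψ q.2| ≤
      D * (C + ε) * C * IW := by
    have i1 : IntegrableOn (fun q : ℝ × ℝ => F (vorticity f g q.1 q.2) * (g q.1 q.2 - q.2) * deriv ψ q.2)
        (Ioc 0 L ×ˢ univ) :=
      kato_integrableOn_strip_of_eq_zero (R := 2 * R + 1) (by fun_prop) fun x _ y hy => by
        simp only [hψ'0' y hy, mul_zero]
    simp only [hIW]
    rw [← integral_const_mul]
    refine abs_integral_le_integral_abs.trans (integral_mono i1.abs (iW.const_mul _) fun q => ?_)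
    rcases q with ⟨x, y⟩
    simp only
    rw [abs_mul, abs_mul]
    have h1 : |F (vorticity f g x y)| ≤ C * Real.exp (-k * |y|) * (C + ε) :=
      (hFb _).trans (mul_le_mul (hωb x y) (by linarith [hωC x y]) (by positivity) (by positivity))
    have hgy : |g x y - y| ≤ C + |y| := by
      have := hT.abs_v_le_const hk x y
      calc |g x y - y| ≤ |g x y| + |y| := abs_sub _ _
        _ ≤ C + |y| := by linarith
    calc |F (vorticity f g x y)| * |g x y - y| * |deriv ψ y| ≤ C * Real.exp (-k * |y|) * (C + ε) * (C + |y|) * D :=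
          mul_le_mul (mul_le_mul h1 hgy (abs_nonneg _) (by positivity)) (hψ'b y) (abs_nonneg _) (by positivity)
      _ = D * (C + ε) * C * ((C + |y|) * Real.exp (-k * |y|)) := by ring
  -- the second term
  have e2 : |∫ q in Ioc 0 L ×ˢ univ, F' (vorticity f g q.1 q.2) * dY (vorticity f g) q.1 q.2 * deriv ψ q.2| ≤
      2 * D * (C + ε) * C * Ik := by
    have i2 : IntegrableOn (fun q : ℝ × ℝ => F' (vorticity f g q.1 q.2) * dY (vorticity f g) q.1 q.2 * deriv ψ q.2)
        (Ioc 0 L ×ˢ univ) :=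
      kato_integrableOn_strip_of_eq_zero (R := 2 * R + 1) (by fun_prop) fun x _ y hy => by
        simp only [hψ'0' y hy, mul_zero]
    simp only [hIk]
    rw [← integral_const_mul]
    refine abs_integral_le_integral_abs.trans (integral_mono i2.abs (ik.const_mul _) fun q => ?_)
    rcases q with ⟨x, y⟩
    simp only
    rw [abs_mul, abs_mul]
    have h1 : |F' (vorticity f g x y)| ≤ 2 * (C + ε) := (hF'b _).trans (by linarith [hωC x y])
    calc |F' (vorticity f g x y)| * |dY (vorticity f g) x y| * |deriv ψ y| ≤ 2 * (C + ε) * (C * Real.exp (-k * |y|)) * D :=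
          mul_le_mul (mul_le_mul h1 (hωyb x y) (abs_nonneg _) (by positivity)) (hψ'b y) (abs_nonneg _) (by positivity)
      _ = 2 * D * (C + ε) * C * Real.exp (-k * |y|) := by ring
  have e3 := mul_le_mul_of_nonneg_left e2 hν
  have e4 : ν * (2 * D * (C + ε) * C * Ik) = D * (C + ε) * C * (2 * ν * Ik) := by ring
  rw [e4] at e3
  calc _ ≤ D * (C + ε) * C * IW + D * (C + ε) * C * (2 * ν * Ik) := add_le_add e1 e3
    _ = D * (C + ε) * C * (IW + 2 * ν * Ik) := by ring

end RhsBound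

/-! ## Continuity in time of the four strip functionals -/

section Continuity

variable {u v : ℝ → ℝ → ℝ → ℝ}

/-- `t ↦ ∫∫ (ωF′(ω) − F(ω))ψ` is continuous on `(0, ∞)` (`ψ` continuous, vanishing for `|y| ≥ R′`). [folklore] -/
theorem clock_continuousOn_A
    (hu : ContDiffOn ℝ 2 (fun q : ℝ × ℝ × ℝ => u q.1 q.2.1 q.2.2) (Ioi 0 ×ˢ univ))
    (hv : ContDiffOn ℝ 2 (fun q : ℝ × ℝ × ℝ => v q.1 q.2.1 q.2.2) (Ioi 0 ×ˢ univ))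
    {F F' : ℝ → ℝ} (cF : Continuous F) (cF' : Continuous F') {ψ : ℝ → ℝ} (cψ : Continuous ψ) {R' : ℝ}
    (hψR : ∀ y, R' ≤ |y| → ψ y = 0) (L : ℝ) :
    ContinuousOn (fun t => ∫ q in Ioc 0 L ×ˢ univ, (vorticity (u t) (v t) q.1 q.2 * F' (vorticity (u t) (v t) q.1 q.2) -
      F (vorticity (u t) (v t) q.1 q.2)) * ψ q.2) (Ioi 0) := by
  have hW := kato_continuousOn_vorticity_spacetime hu hv
  have hψc : ContinuousOn (fun r : ℝ × ℝ × ℝ => ψ r.2.2) (Ioi 0 ×ˢ univ) :=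
    (cψ.comp (continuous_snd.comp continuous_snd)).continuousOn
  exact clock_continuousOn_strip_integral (R' := R') (H := fun r : ℝ × ℝ × ℝ =>
      (vorticity (u r.1) (v r.1) r.2.1 r.2.2 * F' (vorticity (u r.1) (v r.1) r.2.1 r.2.2) -
        F (vorticity (u r.1) (v r.1) r.2.1 r.2.2)) * ψ r.2.2)
    (((hW.mul (cF'.comp_continuousOn hW)).sub (cF.comp_continuousOn hW)).mul hψc)
    (fun t x y _ hy => by simp only [hψR y hy, mul_zero]) L

/-- `t ↦ ∫∫ F(ω)(v − y)θ` is continuous on `(0, ∞)` (`θ` continuous, vanishing for `|y| ≥ R′`). [folklore] -/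
theorem clock_continuousOn_B
    (hu : ContDiffOn ℝ 2 (fun q : ℝ × ℝ × ℝ => u q.1 q.2.1 q.2.2) (Ioi 0 ×ˢ univ))
    (hv : ContDiffOn ℝ 2 (fun q : ℝ × ℝ × ℝ => v q.1 q.2.1 q.2.2) (Ioi 0 ×ˢ univ))
    {F : ℝ → ℝ} (cF : Continuous F) {θ : ℝ → ℝ} (cθ : Continuous θ) {R' : ℝ}
    (hθR : ∀ y, R' ≤ |y| → θ y = 0) (L : ℝ) :
    ContinuousOn (fun t => ∫ q in Ioc 0 L ×ˢ univ, F (vorticity (u t) (v t) q.1 q.2) * (v t q.1 q.2 - q.2) * θ q.2)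
      (Ioi 0) := by
  have hW := kato_continuousOn_vorticity_spacetime hu hv
  have hV : ContinuousOn (fun r : ℝ × ℝ × ℝ => v r.1 r.2.1 r.2.2) (Ioi 0 ×ˢ univ) := hv.continuousOn
  have hy : ContinuousOn (fun r : ℝ × ℝ × ℝ => r.2.2) (Ioi 0 ×ˢ univ) := (continuous_snd.comp continuous_snd).continuousOn
  have hθc : ContinuousOn (fun r : ℝ × ℝ × ℝ => θ r.2.2) (Ioi 0 ×ˢ univ) :=
    (cθ.comp (continuous_snd.comp continuous_snd)).continuousOn
  exact clock_continuousOn_strip_integral (R' := R') (H := fun r : ℝ × ℝ × ℝ =>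
      F (vorticity (u r.1) (v r.1) r.2.1 r.2.2) * (v r.1 r.2.1 r.2.2 - r.2.2) * θ r.2.2)
    (((cF.comp_continuousOn hW).mul (hV.sub hy)).mul hθc)
    (fun t x y _ hy' => by simp only [hθR y hy', mul_zero]) L

/-- `t ↦ ∫∫ F″(ω)|∇ω|²ψ` is continuous on `(0, ∞)` (`ψ` continuous, vanishing for `|y| ≥ R′`). [folklore] -/
theorem clock_continuousOn_C
    (hu : ContDiffOn ℝ 2 (fun q : ℝ × ℝ × ℝ => u q.1 q.2.1 q.2.2) (Ioi 0 ×ˢ univ))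
    (hv : ContDiffOn ℝ 2 (fun q : ℝ × ℝ × ℝ => v q.1 q.2.1 q.2.2) (Ioi 0 ×ˢ univ))
    {F'' : ℝ → ℝ} (cF'' : Continuous F'') {ψ : ℝ → ℝ} (cψ : Continuous ψ) {R' : ℝ}
    (hψR : ∀ y, R' ≤ |y| → ψ y = 0) (L : ℝ) :
    ContinuousOn (fun t => ∫ q in Ioc 0 L ×ˢ univ, F'' (vorticity (u t) (v t) q.1 q.2) *
      (dX (vorticity (u t) (v t)) q.1 q.2 ^ 2 + dY (vorticity (u t) (v t)) q.1 q.2 ^ 2) * ψ q.2) (Ioi 0) := by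
  have hW := kato_continuousOn_vorticity_spacetime hu hv
  have hX := clock_continuousOn_dX_vorticity_spacetime hu hv
  have hY := clock_continuousOn_dY_vorticity_spacetime hu hv
  have hψc : ContinuousOn (fun r : ℝ × ℝ × ℝ => ψ r.2.2) (Ioi 0 ×ˢ univ) :=
    (cψ.comp (continuous_snd.comp continuous_snd)).continuousOn
  exact clock_continuousOn_strip_integral (R' := R') (H := fun r : ℝ × ℝ × ℝ =>
      F'' (vorticity (u r.1) (v r.1) r.2.1 r.2.2) *
        (dX (vorticity (u r.1) (v r.1)) r.2.1 r.2.2 ^ 2 + dY (vorticity (u r.1) (v r.1)) r.2.1 r.2.2 ^ 2) * ψ r.2.2)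
    (((cF''.comp_continuousOn hW).mul ((hX.pow 2).add (hY.pow 2))).mul hψc)
    (fun t x y _ hy => by simp only [hψR y hy, mul_zero]) L

/-- `t ↦ ∫∫ F′(ω)∂_yω θ` is continuous on `(0, ∞)` (`θ` continuous, vanishing for `|y| ≥ R′`). [folklore] -/
theorem clock_continuousOn_E
    (hu : ContDiffOn ℝ 2 (fun q : ℝ × ℝ × ℝ => u q.1 q.2.1 q.2.2) (Ioi 0 ×ˢ univ))
    (hv : ContDiffOn ℝ 2 (fun q : ℝ × ℝ × ℝ => v q.1 q.2.1 q.2.2) (Ioi 0 ×ˢ univ))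
    {F' : ℝ → ℝ} (cF' : Continuous F') {θ : ℝ → ℝ} (cθ : Continuous θ) {R' : ℝ}
    (hθR : ∀ y, R' ≤ |y| → θ y = 0) (L : ℝ) :
    ContinuousOn (fun t => ∫ q in Ioc 0 L ×ˢ univ, F' (vorticity (u t) (v t) q.1 q.2) *
      dY (vorticity (u t) (v t)) q.1 q.2 * θ q.2) (Ioi 0) := by
  have hW := kato_continuousOn_vorticity_spacetime hu hv
  have hY := clock_continuousOn_dY_vorticity_spacetime hu hv
  have hθc : ContinuousOn (fun r : ℝ × ℝ × ℝ => θ r.2.2) (Ioi 0 ×ˢ univ) :=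
    (cθ.comp (continuous_snd.comp continuous_snd)).continuousOn
  exact clock_continuousOn_strip_integral (R' := R') (H := fun r : ℝ × ℝ × ℝ =>
      F' (vorticity (u r.1) (v r.1) r.2.1 r.2.2) * dY (vorticity (u r.1) (v r.1)) r.2.1 r.2.2 * θ r.2.2)
    (((cF'.comp_continuousOn hW).mul hY).mul hθc)
    (fun t x y _ hy => by simp only [hθR y hy, mul_zero]) L

end Continuity

/-! ## The balance integrated in time at one level -/

section Level

/-- **The renormalised negative-enstrophy balance at one regularisation / cutoff level, integrated in time
(registered sub-goal `stub_negEnstrophyLaw_level`).** Along a classical solution of the stretched layer system on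
`(0, ∞)` (`ν ≥ 0`, `L > 0`), for `F ∈ C²(ℝ)` with `|F(s)| ≤ |s|(|s| + ε)`, `|F′(s)| ≤ 2(|s| + ε)` (`ε ≥ 0`), a cutoff `ψ`
(`C¹`, `|ψ| ≤ 1`, `ψ = 0` for `|y| ≥ 2R`, `|ψ′| ≤ D` supported in `|y| ≤ 2R`), and `0 < s ≤ t′` with shear tails
`SliceTails C k` on `[s, t′]`: with `N(τ) = ∫∫ F(ω(τ))ψ`, `A(τ) = ∫∫ (ωF′(ω) − F(ω))ψ`, `C(τ) = ∫∫ F″(ω)|∇ω|²ψ`,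
`|N(t′) − N(s) − ∫_s^{t′} (A − νC)| ≤ (t′ − s)·D(C + ε)C(∫∫(C + |y|)e^{−k|y|} + 2ν∫∫e^{−k|y|})`
(`N′ = A + B − νC − νE` by tools B/C, the fundamental theorem of calculus, and `|B| + ν|E| = O(D)`). [folklore] -/
theorem stub_negEnstrophyLaw_level : ∀ (ν L : ℝ) (u v p : ℝ → ℝ → ℝ → ℝ) (F F' F'' ψ : ℝ → ℝ)
    (ε R D C k s t' : ℝ),
    IsStretchedLayerNSSolutionOn (Ioi 0) ν 1 1 L u v p → 0 ≤ ν → 0 < L →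
    (∀ r, HasDerivAt F (F' r) r) → (∀ r, HasDerivAt F' (F'' r) r) → ContDiff ℝ 1 F' → Continuous F'' →
    0 ≤ ε → (∀ r, |F r| ≤ |r| * (|r| + ε)) → (∀ r, |F' r| ≤ 2 * (|r| + ε)) →
    ContDiff ℝ 1 ψ → (∀ y, |ψ y| ≤ 1) → (∀ y, 2 * R ≤ |y| → ψ y = 0) →
    (∀ y, |deriv ψ y| ≤ D) → (∀ y, 2 * R < |y| → deriv ψ y = 0) →
    0 < k → 0 < s → s ≤ t' → (∀ τ ∈ Icc s t', SliceTails C k (u τ) (v τ)) →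
      |(∫ q in Ioc 0 L ×ˢ univ, F (vorticity (u t') (v t') q.1 q.2) * ψ q.2) -
          (∫ q in Ioc 0 L ×ˢ univ, F (vorticity (u s) (v s) q.1 q.2) * ψ q.2) -
          ∫ τ in s..t', ((∫ q in Ioc 0 L ×ˢ univ, (vorticity (u τ) (v τ) q.1 q.2 * F' (vorticity (u τ) (v τ) q.1 q.2) -
              F (vorticity (u τ) (v τ) q.1 q.2)) * ψ q.2) -
            ν * ∫ q in Ioc 0 L ×ˢ univ, F'' (vorticity (u τ) (v τ) q.1 q.2) *
              (dX (vorticity (u τ) (v τ)) q.1 q.2 ^ 2 + dY (vorticity (u τ) (v τ)) q.1 q.2 ^ 2) * ψ q.2)| ≤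
        (t' - s) * (D * (C + ε) * C * ((∫ q in Ioc 0 L ×ˢ univ, (C + |q.2|) * Real.exp (-k * |q.2|)) +
          2 * ν * ∫ q in Ioc 0 L ×ˢ univ, Real.exp (-k * |q.2|))) := by
  intro ν L u v p F F' F'' ψ ε R D C k s t' hsol hν hL hF hF' hF'1 hF''c hε hFb hF'b hψ hψ1 hψR hψ'b hψ'0
    hk hs hst hST
  -- the four strip functionals
  set N : ℝ → ℝ := fun τ => ∫ q in Ioc 0 L ×ˢ univ, F (vorticity (u τ) (v τ) q.1 q.2) * ψ q.2 with hN
  set A : ℝ → ℝ := fun τ => ∫ q in Ioc 0 L ×ˢ univ, (vorticity (u τ) (v τ) q.1 q.2 *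
    F' (vorticity (u τ) (v τ) q.1 q.2) - F (vorticity (u τ) (v τ) q.1 q.2)) * ψ q.2 with hA
  set B : ℝ → ℝ := fun τ => ∫ q in Ioc 0 L ×ˢ univ, F (vorticity (u τ) (v τ) q.1 q.2) * (v τ q.1 q.2 - q.2) *
    deriv ψ q.2 with hB
  set Cf : ℝ → ℝ := fun τ => ∫ q in Ioc 0 L ×ˢ univ, F'' (vorticity (u τ) (v τ) q.1 q.2) *
    (dX (vorticity (u τ) (v τ)) q.1 q.2 ^ 2 + dY (vorticity (u τ) (v τ)) q.1 q.2 ^ 2) * ψ q.2 with hCf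
  set E : ℝ → ℝ := fun τ => ∫ q in Ioc 0 L ×ˢ univ, F' (vorticity (u τ) (v τ) q.1 q.2) *
    dY (vorticity (u τ) (v τ)) q.1 q.2 * deriv ψ q.2 with hE
  set K : ℝ := D * (C + ε) * C * ((∫ q in Ioc 0 L ×ˢ univ, (C + |q.2|) * Real.exp (-k * |q.2|)) +
    2 * ν * ∫ q in Ioc 0 L ×ˢ univ, Real.exp (-k * |q.2|)) with hK
  -- regularity of `F`, `ψ`
  have cF : Continuous F := continuous_iff_continuousAt.2 fun r => (hF r).continuousAt
  have cF' : Continuous F' := hF'1.continuous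
  have cψ : Continuous ψ := hψ.continuous
  have cψ' : Continuous (deriv ψ) := hψ.continuous_deriv le_rfl
  have hψ'R : ∀ y, 2 * R + 1 ≤ |y| → deriv ψ y = 0 := fun y hy => hψ'0 y (by linarith)
  -- continuity of the functionals
  have hAc : ContinuousOn A (Ioi 0) := clock_continuousOn_A hsol.contDiffOn_u hsol.contDiffOn_v cF cF' cψ hψR L
  have hBc : ContinuousOn B (Ioi 0) := clock_continuousOn_B hsol.contDiffOn_u hsol.contDiffOn_v cF cψ' hψ'R L
  have hCc : ContinuousOn Cf (Ioi 0) := clock_continuousOn_C hsol.contDiffOn_u hsol.contDiffOn_v hF''c cψ hψR L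
  have hEc : ContinuousOn E (Ioi 0) := clock_continuousOn_E hsol.contDiffOn_u hsol.contDiffOn_v cF' cψ' hψ'R L
  have hsub : uIcc s t' ⊆ Ioi 0 := fun τ hτ => by
    rw [uIcc_of_le hst] at hτ; exact hs.trans_le hτ.1
  -- the derivative of `N` on `[s, t']`
  have hderiv : ∀ τ ∈ uIcc s t', HasDerivAt N (A τ + B τ - ν * Cf τ - ν * E τ) τ := by
    intro τ hτ
    rw [uIcc_of_le hst] at hτ
    have hτ0 : 0 < τ := hs.trans_le hτ.1
    have hτI : τ ∈ Ioo (s / 2) (t' + 1) := ⟨by linarith [hτ.1], by linarith [hτ.2]⟩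
    have h1 := stub_negEnstrophyLaw_timeDerivative u v F F' ψ L (2 * R) (s / 2) (t' + 1) τ hsol.contDiffOn_u
      hsol.contDiffOn_v hF cF' cψ hψ1 hψR (by positivity) hτI
    have h2 := clock_slice_identity hsol hL hτ0 hF hF' hF'1 hF''c hψ hψR
    exact h1.congr_deriv h2
  -- the fundamental theorem of calculus and the splitting of the right-hand side
  have hcont : ContinuousOn (fun τ => A τ + B τ - ν * Cf τ - ν * E τ) (uIcc s t') :=
    (((hAc.add hBc).sub (continuousOn_const.mul hCc)).sub (continuousOn_const.mul hEc)).mono hsub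
  have hFTC := intervalIntegral.integral_eq_sub_of_hasDerivAt hderiv hcont.intervalIntegrable
  have hI1 : IntervalIntegrable (fun τ => A τ - ν * Cf τ) volume s t' :=
    ((hAc.sub (continuousOn_const.mul hCc)).mono hsub).intervalIntegrable
  have hI2 : IntervalIntegrable (fun τ => B τ - ν * E τ) volume s t' :=
    ((hBc.sub (continuousOn_const.mul hEc)).mono hsub).intervalIntegrable
  have hsplit : ∫ τ in s..t', (A τ + B τ - ν * Cf τ - ν * E τ) =
      (∫ τ in s..t', (A τ - ν * Cf τ)) + ∫ τ in s..t', (B τ - ν * E τ) := by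
    rw [← intervalIntegral.integral_add hI1 hI2]
    congr 1
    funext τ
    ring
  -- the remainder is `O(D)`
  have hrem : |∫ τ in s..t', (B τ - ν * E τ)| ≤ K * |t' - s| := by
    have h := intervalIntegral.norm_integral_le_of_norm_le_const (a := s) (b := t') (C := K)
      (f := fun τ => B τ - ν * E τ) ?_
    · rw [Real.norm_eq_abs] at h
      exact h
    intro τ hτ
    rw [uIoc_of_le hst] at hτ
    have hτI : τ ∈ Icc s t' := ⟨hτ.1.le, hτ.2⟩
    have hτ0 : 0 < τ := hs.trans hτ.1
    have hτ' : τ ∈ Ioi (0:ℝ) := hτ0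
    have hb := clock_rhs_bound (L := L) hk (hST τ hτI) (hsol.contDiff_u hτ') (hsol.contDiff_v hτ')
      (hsol.divFree τ hτ') cF cF' hε hFb hF'b hψ hψ'b hψ'0 hν
    rw [Real.norm_eq_abs]
    calc |B τ - ν * E τ| ≤ |B τ| + |ν * E τ| := abs_sub _ _
      _ = |B τ| + ν * |E τ| := by rw [abs_mul, abs_of_nonneg hν]
      _ ≤ K := hb
  -- conclusion
  have e : N t' - N s - ∫ τ in s..t', (A τ - ν * Cf τ) = ∫ τ in s..t', (B τ - ν * E τ) := by
    rw [← hFTC, hsplit]; ring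
  rw [e]
  calc |∫ τ in s..t', (B τ - ν * E τ)| ≤ K * |t' - s| := hrem
    _ = (t' - s) * K := by rw [abs_of_nonneg (sub_nonneg.2 hst)]; ring

end Level

end Summit.AnomalousDissipation.AnomalousDissipation.Theorems.StrainedLayerLaw.LogEnstrophyClock

end
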